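import Summits.Ventures.CertifiedManyBodySolver.Rows.CorrWindowCertKernelFormGram
import HarnessLib

/-!
# KERNEL FORM, IDENTITY LEVEL: the tree's window-certificate OPERATOR IDENTITY `hcert` from SYNTACTIC certificate data —
# `windowIdentity_of_residTG` (the joint between the CAR normal-ordering engine and EVERY soundness shape: vertex rows,
# pinned pairs, foreign-`t'` transport)

HONEST FRAMING: Lean plumbing towards «tier P». The kernel theorems `affineOrbitLowerRowN_of_kernelCert{,G,TB}`
(`Rows/CorrWindowCertKernelForm{,Gram}.lean`) go straight from ONE decidable inequality to the single-VERTEX claim-node predicate;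
inside, their steps (1)–(3) manufacture the OPERATOR IDENTITY `hcert` that the Literature soundness theorems
(`IsTorusLimitOf.re_sum_expect_d4_ge_of_window_certificate_TT'_affine₂` and kin) take as a hypothesis. The PAIR-node path
(HOME/STATUS captain rulings «collision #4»: a state-level vertex-transport lemma consuming the SAME identity at a foreign `t'`, then
two vertices sharing the eom words) needs that identity AS A LEMMA, not buried in a proof. This file exposes it, SHAPE-FREE: the
window Hamiltonian and the mean-energy observable enter as ABSTRACT operators `Hsem`, `Esem` with dictionary equations
`termOp d TH = Hsem`, `termOp d TE = Esem` (so the identity holds at any `(t, t', U)`, for any window, with the Gram family any term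
list denoting a `gramForm Λ O`); no positivity, no sign, no state, no limit is involved — it is an identity in `𝔄_{Λ'}`. Nothing of
record moves; no claim node is discharged; CONTROL/CALIBRATION context (wording (xx1)); no summit statement is proved by this file.
Seat hubbard-obs-p2 (STIFFNESS), `prover-hubbard-obs-p2-g22-0`, zero compute.

THE STATEMENT (`windowIdentity_of_residTG`). With `R := normalize enc B (residTG TX μ ν o κhi hi κlo lo TE TG TH f EB g SY CW AV)`:
  `termOp d TX − constCoeff R • 1 − Σ_σ μ_σ • (n_{0σ} − ν • 1) − κhi • (hi • 1 − Esem) − κlo • (Esem − lo • 1)`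
  `= gramForm Λ O + (Σ_k (Hsem · Γ(incl) B_k − Γ(incl) B_k · Hsem) + Σ_l (Γ(incl_l) Γ(d4Emb γ_l v_l) Y_l − Γ(incl) Y_l) + Σ_j b_j • w_j)`
  `  + (Σ_m 1 • (V_mᴴ − V_m) + Σ_k a_k • word_k)`
with `B_k = termOp dΛ EB_k`, `Y_l = termOp dΛ (SY l)`, `(b_j, w_j)` the charged words of `CW` read through `d`, `V_m = termOp d AV_m`, and
`(a_k, word_k) = (resCoeff R k, resWord d R k)` the non-constant monomials of the normal form — LITERALLY the `hcert` binder shape of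
`…_TT'_affine₂` (index sets `Finset.univ` over positions). Companions: `charged_of_hcw` (the charged-word side condition from the
syntactic test `chargeW ≠ 0 ∨ spinChargeW ≠ 0`) and, already in the tree, `constCoeff_sub_sum_norm_resCoeff`
(`c − Σ‖a_k‖ = lowerConst R`, `Rows/CARPolyWindowResidual.lean`). USAGE: `…_affine₂ … (windowIdentity_of_residTG …) …` re-proves
the vertex kernel theorem in three lines (checked in the seat's scratch, not re-landed); a pair / transport theorem consumes the same
term with its own `Hsem := H^{(1,s_v,U)}_{Λ'}`, `Esem := Γ E^{(1,s_v,U)}`.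

References: J. Wang et al., PRX 14 (2024) 031006 §III [WangEtAl2024]; X. Han, arXiv:2006.06002 §3 [Han2020Bootstrap]; C. Jansson,
D. Chaykin, C. Keil, SIAM J. Numer. Anal. 46 (2008) 180 [JanssonChaykinKeil2008].
-/

noncomputable section

namespace Summit.Ventures.CertifiedManyBodySolver

namespace CARPolyWindow

open Summit.Ventures.CertifiedQuantumChemistry Summit.Ventures.CertifiedQuantumChemistry.CARPoly
open Literature.MathematicalPhysics.QuantumLattice Literature.MathematicalPhysics.QuantumLattice.HubbardWave0
open Literature.MathematicalPhysics.QuantumManyBody.StateRelaxation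
open Literature.Probability.LatticeModels
open Matrix
open scoped ComplexOrder BigOperators

section Identity

variable {α β : Type*} [LinearOrder α]

omit [LinearOrder α] in
/-- **The charged-word side condition from the syntax**: if every word of `CW` has `chargeW ≠ 0 ∨ spinChargeW ≠ 0` (decidable on
letters), then every word read through the letter map `d` has nonzero charge or spin-charge. [cite: Han2020Bootstrap, §3] -/
theorem charged_of_hcw {Λ' : Finset (Site 2)} (d : α → Orb (PolySite Λ')) (sp : α → Fin 2)
    (hsp : ∀ a, (ofLex (d a)).2 = sp a) (CW : Terms α) (hcw : ∀ wc ∈ CW, chargeW wc.1 ≠ 0 ∨ spinChargeW sp wc.1 ≠ 0) :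
    ∀ j ∈ (Finset.univ : Finset (Fin CW.length)),
      ladderCharge (wmap d (CW.get j).1) ≠ 0 ∨ ladderSpinCharge (wmap d (CW.get j).1) ≠ 0 := by
  intro j _
  rw [ladderCharge_wmap, ladderSpinCharge_wmap d sp hsp]
  exact hcw _ (List.get_mem CW j)

/-- **KERNEL FORM, IDENTITY LEVEL: the window-certificate operator identity `hcert` (binder shape of `…_TT'_affine₂`) from the
syntactic residual `residTG` and its collected normal form `R`** — shape-free: abstract window Hamiltonian `Hsem` and mean-energy
operator `Esem` given by dictionary equations, abstract Gram term list `TG` denoting `gramForm Λ O`; constant `c := constCoeff R`,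
residual family `(resCoeff R, resWord d R)`. [cite: WangEtAl2024, §III] [cite: JanssonChaykinKeil2008, §3] -/
theorem windowIdentity_of_residTG
    {Λ Λ' : Finset (Site 2)} (hΛ : Λ ⊆ Λ') (hz : (0 : Site 2) ∈ Λ')
    -- letters
    (d : α → Orb (PolySite Λ')) (hd : Function.Injective d) (enc : α → ℕ) (Bkey : ℕ)
    (dΛ : β → Orb (PolySite Λ)) (f : β → α) (hf : ∀ b, d (f b) = Orb.embMap (PolySite.incl hΛ) (dΛ b))
    -- dictionaries (abstract)
    (TH : Terms α) (Hsem : FermionOp Λ') (hH : termOp d TH = Hsem)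
    (TE : Terms α) (Esem : FermionOp Λ') (hE : termOp d TE = Esem)
    (o : Fin 2 → α) (ho : ∀ σ, d (o σ) = orb (PolySite.pt 0 hz) σ)
    -- certificate data
    (TX : Terms α) (μ : Fin 2 → ℚ) (ν κhi hi κlo lo : ℚ)
    (TG : Terms α) {m : Type*} [Fintype m] [DecidableEq m] (Λm : Matrix m m ℂ) (O : m → FermionOp Λ')
    (hTG : termOp d TG = gramForm Λm O) (EB : List (Terms β))
    {nS : ℕ} (γ : Fin nS → DihedralGroup 4) (wv : Fin nS → Site 2)
    (hsh : ∀ l, d4ShiftSet (γ l) (wv l) Λ ⊆ Λ') (g : Fin nS → β → α)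
    (hg : ∀ l b, d (g l b) = Orb.embMap (PolySite.incl (hsh l)) (Orb.embMap (PolySite.d4Emb (γ l) (wv l) Λ) (dΛ b)))
    (SY : Fin nS → Terms β) (CW : Terms α) (AV : List (Terms α))
    -- the normal form
    {R : CARPoly.Poly α} (hR : CARPoly.normalize enc Bkey (residTG TX μ ν o κhi hi κlo lo TE TG TH f EB g SY CW AV) = R) :
    termOp d TX - (((constCoeff R : ℚ) : ℝ) : ℂ) • (1 : FermionOp Λ') -
        ∑ σ : Fin 2, (((μ σ : ℚ) : ℝ) : ℂ) • (nAt 0 hz σ - (((ν : ℚ) : ℝ) : ℂ) • (1 : FermionOp Λ')) -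
        (((κhi : ℚ) : ℝ) : ℂ) • ((((hi : ℚ) : ℝ) : ℂ) • (1 : FermionOp Λ') - Esem) -
        (((κlo : ℚ) : ℝ) : ℂ) • (Esem - (((lo : ℚ) : ℝ) : ℂ) • (1 : FermionOp Λ')) =
      gramForm Λm O +
        (∑ k ∈ (Finset.univ : Finset (Fin EB.length)),
            (Hsem * fermionEmbed (PolySite.incl hΛ) (termOp dΛ (EB.get k)) -
              fermionEmbed (PolySite.incl hΛ) (termOp dΛ (EB.get k)) * Hsem) +
          ∑ l ∈ (Finset.univ : Finset (Fin nS)),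
            (fermionEmbed (PolySite.incl (hsh l)) (fermionEmbed (PolySite.d4Emb (γ l) (wv l) Λ) (termOp dΛ (SY l))) -
              fermionEmbed (PolySite.incl hΛ) (termOp dΛ (SY l))) +
          ∑ j ∈ (Finset.univ : Finset (Fin CW.length)), (((CW.get j).2 : ℚ) : ℂ) • ladderWord (wmap d (CW.get j).1)) +
        (∑ m' ∈ (Finset.univ : Finset (Fin AV.length)),
            (((1 : ℝ) : ℝ) : ℂ) • ((termOp d (AV.get m'))ᴴ - termOp d (AV.get m')) +
          ∑ k ∈ (Finset.univ : Finset (Fin R.length)), resCoeff R k • ladderWord (resWord d R k)) := by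
  -- names for the semantic pieces
  set Dn : FermionOp Λ' := ∑ σ : Fin 2, (((μ σ : ℚ) : ℝ) : ℂ) • (nAt 0 hz σ - (((ν : ℚ) : ℝ) : ℂ) • (1 : FermionOp Λ'))
    with hDn
  set Er : FermionOp Λ' := (((κhi : ℚ) : ℝ) : ℂ) • ((((hi : ℚ) : ℝ) : ℂ) • (1 : FermionOp Λ') - Esem) +
      (((κlo : ℚ) : ℝ) : ℂ) • (Esem - (((lo : ℚ) : ℝ) : ℂ) • (1 : FermionOp Λ')) with hEr
  set G : FermionOp Λ' := gramForm Λm O with hG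
  set EOM : FermionOp Λ' := ∑ k ∈ (Finset.univ : Finset (Fin EB.length)),
      (Hsem * fermionEmbed (PolySite.incl hΛ) (termOp dΛ (EB.get k)) -
        fermionEmbed (PolySite.incl hΛ) (termOp dΛ (EB.get k)) * Hsem) with hEOM
  set SYM : FermionOp Λ' := ∑ l ∈ (Finset.univ : Finset (Fin nS)),
      (fermionEmbed (PolySite.incl (hsh l)) (fermionEmbed (PolySite.d4Emb (γ l) (wv l) Λ) (termOp dΛ (SY l))) -
        fermionEmbed (PolySite.incl hΛ) (termOp dΛ (SY l))) with hSYM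
  set CHG : FermionOp Λ' := ∑ j ∈ (Finset.univ : Finset (Fin CW.length)),
      (((CW.get j).2 : ℚ) : ℂ) • ladderWord (wmap d (CW.get j).1) with hCHG
  set AH : FermionOp Λ' := ∑ m' ∈ (Finset.univ : Finset (Fin AV.length)),
      (((1 : ℝ) : ℝ) : ℂ) • ((termOp d (AV.get m'))ᴴ - termOp d (AV.get m')) with hAH
  set RES : FermionOp Λ' := ∑ k ∈ (Finset.univ : Finset (Fin R.length)), resCoeff R k • ladderWord (resWord d R k)
    with hRES
  have ec : ∀ r : ℚ, ((((r : ℚ) : ℝ) : ℝ) : ℂ) = ((r : ℚ) : ℂ) := fun r => Complex.ofReal_ratCast r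
  -- (1) what the residual denotes
  have key : termOp d (residTG TX μ ν o κhi hi κlo lo TE TG TH f EB g SY CW AV) =
      termOp d TX - Dn - Er - G - EOM - SYM - CHG - AH := by
    have hD : termOp d ((finL 2).flatMap fun σ => scaleT (μ σ) (densT o ν σ)) = Dn := by
      rw [termOp_flatMap_finL, hDn]
      refine Finset.sum_congr rfl fun σ _ => ?_
      rw [termOp_scaleT, termOp_densT d hz o ho, ec, ec]
    have hEr' : termOp d (scaleT κhi (unitT hi ++ negT TE)) + termOp d (scaleT κlo (TE ++ unitT (-lo))) = Er := by
      rw [termOp_scaleT, termOp_scaleT, termOp_append, termOp_append, termOp_negT, termOp_unitT, termOp_unitT, hE,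
        hEr, ec, ec, ec, ec, Rat.cast_neg, neg_smul, ← sub_eq_add_neg, ← sub_eq_add_neg]
    have hGr : termOp d TG = G := by rw [hG, hTG]
    have hEo : termOp d (eomTβ TH f EB) = EOM := by
      rw [termOp_eomTβ hΛ d dΛ f hf, hH, hEOM]
    have hSy : termOp d (symT f g SY) = SYM := by
      rw [termOp_symT hΛ d dΛ f hf γ wv hsh g hg, hSYM]
    have hCh : termOp d CW = CHG := by rw [termOp_eq_sum_get, hCHG]
    have hAh : termOp d (ahT AV) = AH := by rw [termOp_ahT, hAH]
    rw [residTG, termOp_append, termOp_append, termOp_append, termOp_append, termOp_append, termOp_append, termOp_append,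
      termOp_append, termOp_negT, termOp_negT, termOp_negT, termOp_negT, termOp_negT, termOp_negT, termOp_negT, termOp_negT,
      hD, hGr, hEo, hSy, hCh, hAh, ← hEr']
    abel
  -- (2) the collected normal form denotes the same operator and splits into constant + residual family
  have hsplit : termOp d TX - Dn - Er - G - EOM - SYM - CHG - AH =
      ((((constCoeff R : ℚ) : ℝ) : ℝ) : ℂ) • (1 : FermionOp Λ') + RES := by
    rw [← key, ← evalPoly_normalize' hd enc Bkey, hR, ec, hRES]
    exact evalPoly_eq_const_add_residual d R
  -- (3) rearrange
  rw [← sub_eq_zero]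
  have e : termOp d TX - ((((constCoeff R : ℚ) : ℝ) : ℝ) : ℂ) • (1 : FermionOp Λ') - Dn -
        (((κhi : ℚ) : ℝ) : ℂ) • ((((hi : ℚ) : ℝ) : ℂ) • (1 : FermionOp Λ') - Esem) -
        (((κlo : ℚ) : ℝ) : ℂ) • (Esem - (((lo : ℚ) : ℝ) : ℂ) • (1 : FermionOp Λ')) -
        (G + (EOM + SYM + CHG) + (AH + RES)) =
      (termOp d TX - Dn - Er - G - EOM - SYM - CHG - AH) -
        (((((constCoeff R : ℚ) : ℝ) : ℝ) : ℂ) • (1 : FermionOp Λ') + RES) := by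
    rw [hEr]; abel
  rw [e, hsplit, sub_self]

end Identity

end CARPolyWindow

end Summit.Ventures.CertifiedManyBodySolver

end
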